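import Summits.BirchSwinnertonDyer.BirchSwinnertonDyer.Theorems.CumulativeHeegnerLeopoldtCumulativeHeegnerInclusionAtThreeVanishingDoorNumeric
import Summits.BirchSwinnertonDyer.BirchSwinnertonDyer.Theorems.SchneiderFreeAdditiveX3BranchIMCKrizLiLocus
import Literature.NumberTheory.EllipticCurves.AnticyclotomicPConverseLinks
import HarnessLib

/-!
# Crux K1 `CumulativeHeegnerInclusionAtThree` (stmt-BirchSwinnertonDyer-24198) / crux A (26896): the VANISHING DOOR
# on the KRIZ–LI LOCUS — Kriz–Li 2019 Thm. 1.20 (typed: `KrizLi2019.thm120_padicLogHeegner_unit_of_bernoulli`)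
# discharges THREE of the four numerics of `…VanishingDoorNumeric` at once

Width seat bsd-line-chl-k1-p1-w2 g8 (`--supports stmt-BirchSwinnertonDyer-24198`); the follow-up named by -w2 g7
(p645092, «compose `_pointwise_of_numerics` with Kriz–Li Thm. 1.20 once typed») — the fact was ALREADY in the tree
(`Literature/NumberTheory/EllipticCurves/KrizLi2019/EisensteinHeegnerLog.lean`, bsd-cm request, 2026-08-27), so no
typer act is needed. Theorems only; no definition, no named fact minted, no `sorry`; imports no `Theses` module.

## What is proved

p645092 (`…VanishingDoorNumeric.cell_selmerAcBase_eq_bot_of_numerics`) needs FOUR numerics at a rank-one datum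
`(E, K, P)` on the Leopoldt cell and a degree-one `𝔭′ ∋ 3`: `Ш(E/K)[3^∞] = 0`, `3 ∤ ∏_{w∣3} c_w(E/K)`,
`3 ∤ [E(K):ℤP]`, `ord₃ log_ω P = 0` (and `P` non-torsion). Kriz–Li's PRINTED conclusion at an Eisenstein prime —
«`(|Ẽ^{ns}(𝔽_p)|/p) · log_{ω_E} P ≢ 0 (mod p)`», `log_{ω_E} = log_{ω_𝓔}/c` — read at `p = 3` through the
embedding `embAt K 3 𝔭′` and for a constant `c` with `3 ∤ c`, gives on the cell (`|Ẽ^{ns}(𝔽₃)| = 3`, additive):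

* §1 `not_isOfFinAddOrder_of_padicLogOmega_ne_zero` (generic: a torsion point has `log_{ω_𝓔} = 0`, tree lemma
  `AcPConverseLinks.padicLogPoint_formalIndex_smul_eq_zero_of_isOfFinAddOrder`) and `cell_padicLogOrd_le_zero_of_krizLi`:
  `log_{ω_𝓔} P ≠ 0` (so `P` is NON-TORSION) and `ord₃ log_{ω_𝓔} P ≤ ord₃ c = 0`
  (`SchneiderFree.padicLogOrd_le_padicValInt_of_krizLi`, `SchneiderFree.nsPointCount_eq_self_of_addv`).
* §2 **`cell_selmerAcBase_eq_bot_of_krizLi`**: with `Ш(E/K)[3^∞] = 0` and `3 ∤ ∏_{w∣3} c_w(E/K)` the exact count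
  ON THE CELL (`…VanishingDoorNumeric.cell_natCard_selmerAcBase_mul_eq`: `#Sel_{𝔭′}(K,E[3^∞])·#E(ℚ₃)[3^∞] = 3^a`,
  `a = 2·(ord₃ log_ω P − ord₃[E(K):ℤP]) ∈ ℕ`) and `ord₃ log_ω P ≤ 0 ≤ ord₃[E(K):ℤP]` force `a = 0`: hence
  **`Sel_{𝔭′}(K, E[3^∞]) = 0`, `ord₃ log_ω P = 0` AND `ord₃[E(K):ℤP] = 0`** — the index numeric and the unit-log
  numeric of p645092 are CONSEQUENCES of Kriz–Li's display (Kriz–Li p. 21: «unit log ⟹ `p ∤ [E(K):ℤP]`», here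
  kernel-checked from the count), and non-torsion of `P` too.
* §3 **`cumulativeHeegnerInclusionAtThree_pointwise_of_krizLi`**: on that sub-cell, for every `ℤ₃`-extension `κ`,
  generator `γ` and EVERY `L : UnrSeries 3`, the conclusion of K1 verbatim (`Ch_Λ X_{∅,0}(𝔭′) = Λ`, via
  `…VanishingDoor.cumulativeHeegnerInclusionAtThree_pointwise_of_atoms`; A's tempered shape follows with `μ = 0`).
* §4 **`cumulativeHeegnerInclusionAtThree_pointwise_of_thm120`**: the BY-NAME form — Kriz–Li 2019 Thm. 1.20 as the
  hypothesis `hKL : KrizLi2019.thm120_padicLogHeegner_unit_of_bernoulli`, its curve-level binders (a primitive `ψ` of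
  conductor `f`, the Teichmüller `ω`, `E[3]^{ss} ≅ 𝔽₃(ψ) ⊕ 𝔽₃(ψ⁻¹ω)` in trace form, (1) `ψ(3) ≠ 1 ≠ (ψ⁻¹ω)(3)`,
  (2) no split multiplicative prime, (3) the additive-prime condition) and `K`-level binders (Kronecker character
  `ε_K`, (4) `B_{1,ψ₀⁻¹ε_K}·B_{1,ψ₀ω⁻¹} ≢ 0 (mod 3)`), a parametrisation datum `D` of level `N_E` with `3 ∤ D.c`
  (its constant), a Heegner datum `H` and THE Heegner point `P` (`ι(P) = heegnerPointComplex D H`), on the Leopoldt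
  cell with `rank E(K) = 1`, `Ш(E/K)[3^∞] = 0`, `3 ∤ ∏_w c_w(E/K)` ⟹ K1's conclusion at every degree-one `𝔭′ ∋ 3`,
  every `κ`, `γ`, `L`; and `…_of_thm120_of_kolyvagin`: the same with `rank E(K) = 1` supplied by KOLYVAGIN BY NAME
  (tree fact `kolyvagin N_W W K`, fed with the non-torsion of `P` that Kriz–Li's display gives).

READING (numbers, not adjectives). On the Kriz–Li locus of the Leopoldt cell the `T = 0` door needs only TWO numerics
(`Ш(E/K)[3^∞] = 0`, `3 ∤ Tam(E/K)`) and `3 ∤ c(D)`; the research interior of A (`n ≥ 1`, census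
A26896-LINE-CENSUS-g6 §2) is untouched. Hypothesis (1) of Kriz–Li IS the cell's two-sided non-anomalous clause read on
Dirichlet characters; the two are carried side by side (the dictionary Galois line ↔ Dirichlet character is class
field theory over `ℚ`, not in the tree). CONDITIONAL, exactly like p645092 / X11b / UTD tier U, on
`poitouTate_selmerStructure_duality K` (Milne ADT I 4.10(b)) and `localEulerPoincareCharacteristic` (I 2.8), and in
§4 on `hKL`. Closes nothing by itself (K1/A quantify over the whole cell and every frame). BSD is not proved by any of
this; no summit statement is proved by this seat; K1 24198 (= A research + P print) and A 26896 stay OPEN; the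
skeleton of record (birth v5 59217cca) is untouched.

References: [KrizLi2019] D. Kriz, C. Li, *Goldfeld's conjecture and congruences between Heegner points*, Forum
Math. Sigma 7 (2019) e15, Thm. 1.20 (pp. 7–8) = Thm. 7.1 (pp. 42–43), Rem. 1.17 (p. 6), p. 21 (unit log and the
index); [JetchevSkinnerWan2017] Prop. 3.2.1, (7.1.5); [Castella2018] Thm. 2.3; [GreenbergLNM1716] §4 Lemma 4.2;
[MilneADT2006] I 4.10(b), 2.8; [SilvermanAEC2009] IV.6.4, VII.2.2, VII.6.1.
-/

set_option linter.dupNamespace false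
set_option autoImplicit false

noncomputable section

open scoped Classical

open NumberField IsDedekindDomain Field WeierstrassCurve
open Literature.NumberTheory.EllipticCurves Literature.NumberTheory.EllipticCurves.GreenbergSelmer
open Literature.NumberTheory.EllipticCurves.ModularForms
open Literature.NumberTheory.GaloisRepresentations Literature.NumberTheory.GaloisCohomology

namespace Summit.BirchSwinnertonDyer.BirchSwinnertonDyer.Theorems.CumulativeHeegnerInclusionAtThreeVanishingDoorKrizLi

open Summit.BirchSwinnertonDyer.Rank1Residual
open Summit.BirchSwinnertonDyer.Rank1Residual.X11b
open Summit.BirchSwinnertonDyer.Rank1Residual.X11b.AcSelmer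
open Summit.BirchSwinnertonDyer.Rank1Residual.X11b.Halves
open Summit.BirchSwinnertonDyer.BirchSwinnertonDyer.Theorems.CumulativeHeegnerInclusionAtThreeVanishingDoor
open Summit.BirchSwinnertonDyer.BirchSwinnertonDyer.Theorems.CumulativeHeegnerInclusionAtThreeBaseSelmerCount
open Summit.BirchSwinnertonDyer.BirchSwinnertonDyer.Theorems.CumulativeHeegnerInclusionAtThreeVanishingDoorNumeric
open Summit.BirchSwinnertonDyer.BirchSwinnertonDyer.Theorems.UniversalToricDescentTwinSplit.VanishingControl

/-! ## §1 Kriz–Li's display on the cell: non-torsion and `ord₃ log_ω P ≤ 0` -/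

section Valuation

variable {W : WeierstrassCurve ℚ} [W.IsElliptic] [W.IsGloballyMinimal] {p : ℕ} [Fact p.Prime]
  {K : Type} [Field K] [NumberField K] {ι : K →+* ℚ_[p]} {P : (W.baseChange K).toAffine.Point}

/-- **A point with non-zero `p`-adic logarithm is non-torsion**: `log_{ω_𝓔} P = log_W(z(m₀ • P_ι))/m₀`
(`Castella2018.padicLogOmega`) and a torsion `P` has `log_W(z(m₀ • P_ι)) = 0`
(`AcPConverseLinks.padicLogPoint_formalIndex_smul_eq_zero_of_isOfFinAddOrder`). The «In particular, `P` is of infinite order» of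
Kriz–Li Thm. 1.20, generic in `p`. [cite: KrizLi2019, Thm. 1.20 (p. 8, "In particular, P ∈ E(K) is of infinite order")]
[cite: SilvermanAEC2009, IV.6.4 and VII.2.2] -/
theorem not_isOfFinAddOrder_of_padicLogOmega_ne_zero (h : Castella2018.padicLogOmega W p ι P ≠ 0) :
    ¬ IsOfFinAddOrder P := by
  intro hP
  apply h
  have h0 := AcPConverseLinks.padicLogPoint_formalIndex_smul_eq_zero_of_isOfFinAddOrder W p ι hP
  unfold Castella2018.padicLogOmega
  rw [h0, zero_div]

/-- **Kriz–Li's display on class O6 with `3 ∤ c` ⟹ `log_{ω_𝓔} P ≠ 0` and `ord₃ log_{ω_𝓔} P ≤ 0`.** At an additive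
`3` (`ClassO6 W 3 ⊇ Addv W 3`) `|Ẽ^{ns}(𝔽₃)| = 3` (`SchneiderFree.nsPointCount_eq_self_of_addv`), so
«`(|Ẽ^{ns}(𝔽₃)|/3)·log_{ω_𝓔} P/c ≢ 0 (mod 3)`» gives `ord₃ log_{ω_𝓔} P ≤ ord₃ c`
(`SchneiderFree.padicLogOrd_le_padicValInt_of_krizLi`) `= 0`. [cite: KrizLi2019, Thm. 1.20 (p. 8) and Rem. 1.17 (p. 6)] -/
theorem cell_padicLogOrd_le_zero_of_krizLi {W : WeierstrassCurve ℚ} [W.IsElliptic] [W.IsGloballyMinimal]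
    {K : Type} [Field K] [NumberField K] {ι : K →+* ℚ_[3]} {P : (W.baseChange K).toAffine.Point} {c : ℤ}
    (hO6 : Additive.ClassO6 W 3) (hc : ¬ (3 : ℤ) ∣ c)
    (hne : ¬ ‖((KrizLi2019.nsPointCount W 3 : ℤ) : ℚ_[3]) / (3 : ℚ_[3]) *
        (Castella2018.padicLogOmega W 3 ι P / (c : ℚ_[3]))‖ ≤ (3 : ℝ)⁻¹) :
    Castella2018.padicLogOmega W 3 ι P ≠ 0 ∧ X11b.padicLogOrd W 3 ι P ≤ 0 := by
  have hns : KrizLi2019.nsPointCount W 3 = ((3 : ℕ) : ℤ) :=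
    SchneiderFree.nsPointCount_eq_self_of_addv (W := W) (p := 3) hO6.2.1
  have hne' : ¬ ‖((KrizLi2019.nsPointCount W 3 : ℤ) : ℚ_[3]) / ((3 : ℕ) : ℚ_[3]) *
      (Castella2018.padicLogOmega W 3 ι P / (c : ℚ_[3]))‖ ≤ ((3 : ℕ) : ℝ)⁻¹ := by
    simpa only [Nat.cast_ofNat] using hne
  obtain ⟨hL, -, hle⟩ := SchneiderFree.padicLogOrd_le_padicValInt_of_krizLi (W := W) (p := 3) hns hne'
  have hc0 : padicValInt 3 c = 0 := padicValInt.eq_zero_of_not_dvd hc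
  rw [hc0] at hle
  exact ⟨hL, by exact_mod_cast hle⟩

end Valuation

/-! ## §2 `Sel_{𝔭′}(K, E[3^∞]) = 0` on the Kriz–Li locus of the cell from TWO numerics -/

/-- **`Sel_{𝔭′}(K, E[3^∞]) = 0`, `ord₃ log_ω P = 0` and `ord₃ [E(K):ℤP] = 0` on the Leopoldt cell from Kriz–Li's
display and two numerics.** On the cell (class O6 at `3`, non-anomalous rational line, `N = N_E`, `K` imaginary
quadratic Heegner for `N`), at a degree-one prime `𝔭′ ∋ 3` with `rank E(K) = 1`, `Ш(E/K)[3^∞] = 0`,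
`3 ∤ ∏_{w∣3} c_w(E/K)`, and a point `P ∈ E(K)` satisfying Kriz–Li's display at `embAt K 3 𝔭′` for some `c ∈ ℤ` with
`3 ∤ c`: the exact count `#Sel·#E(ℚ₃)[3^∞] = 3^a`, `a = 2(ord₃ log_ω P − ord₃[E(K):ℤP]) ∈ ℕ`
(`cell_natCard_selmerAcBase_mul_eq`) with `ord₃ log_ω P ≤ 0` (§1) forces `a = 0`, `ord₃ log_ω P = 0 = ord₃[E(K):ℤP]`
(index `0` = infinite allowed, `padicValNat 3 0 = 0`, as everywhere in the cell), and `P` is non-torsion (§1).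
CONDITIONAL on the two cited cohomological facts. [cite: KrizLi2019, Thm. 1.20 (p. 8), p. 21 (unit log and the index)]
[cite: JetchevSkinnerWan2017, Prop. 3.2.1 and (7.1.5)] [cite: MilneADT2006, Ch. I, Thm. 4.10(b) and Thm. 2.8] -/
theorem cell_selmerAcBase_eq_bot_of_krizLi :
    ∀ (W : WeierstrassCurve ℚ) [W.IsElliptic] [W.IsGloballyMinimal] (N : ℕ) [NeZero N] (K : Type) [Field K]
      [NumberField K], Summit.BirchSwinnertonDyer.Rank1Residual.Additive.ClassO6 W 3 →
      (∃ Φ : AddSubgroup (WeierstrassCurve.geomTorsion W ((3 : ℕ) : ℤ)),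
        Literature.NumberTheory.EllipticCurves.Rank1Residual.IsRationalLine W 3 Φ ∧
        ∀ (v : IsDedekindDomain.HeightOneSpectrum (NumberField.RingOfIntegers ℚ)),
          ((3 : ℕ) : NumberField.RingOfIntegers ℚ) ∈ v.asIdeal → ∀ 𝔓 ∈ v.primesAbove,
          ¬ (∀ g ∈ 𝔓.decompositionSubgroup (Field.absoluteGaloisGroup ℚ), ∀ P ∈ Φ, g • P = P) ∧
          ¬ (∀ g ∈ 𝔓.decompositionSubgroup (Field.absoluteGaloisGroup ℚ),
              ∀ P : WeierstrassCurve.geomTorsion W ((3 : ℕ) : ℤ), g • P - P ∈ Φ)) →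
      W.conductorNorm ℤ = N → Literature.NumberTheory.EllipticCurves.IsImaginaryQuadratic K →
      Literature.NumberTheory.EllipticCurves.SatisfiesHeegnerHypothesis N K →
      poitouTate_selmerStructure_duality K →
      (∀ v : HeightOneSpectrum (𝓞 K), localEulerPoincareCharacteristic (v.adicCompletion K)) →
      ∀ (𝔭' : IsDedekindDomain.HeightOneSpectrum (NumberField.RingOfIntegers K))
        (h𝔭' : ((3 : ℕ) : NumberField.RingOfIntegers K) ∈ 𝔭'.asIdeal)
        (he' : 𝔭'.asIdeal.ramificationIdx (𝓞 ℚ) = 1) (hf' : 𝔭'.asIdeal.inertiaDeg (𝓞 ℚ) = 1),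
      (W.baseChange K).mordellWeilRank = 1 →
      AddCommGroup.primaryComponent (W.baseChange K).sha 3 = ⊥ →
      ¬ 3 ∣ tamagawaProductAbove W K 3 →
      ∀ (P : (W.baseChange K).toAffine.Point) (c : ℤ), ¬ (3 : ℤ) ∣ c →
      ¬ ‖((KrizLi2019.nsPointCount W 3 : ℤ) : ℚ_[3]) / (3 : ℚ_[3]) *
          (Castella2018.padicLogOmega W 3 (embAt K 3 𝔭' h𝔭' he' hf') P / (c : ℚ_[3]))‖ ≤ (3 : ℝ)⁻¹ →
      selmerAcBase (W.baseChange K) 3 𝔭' ∅ = ⊥ ∧ ¬ IsOfFinAddOrder P ∧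
        Summit.BirchSwinnertonDyer.Rank1Residual.X11b.padicLogOrd W 3 (embAt K 3 𝔭' h𝔭' he' hf') P = 0 ∧
        padicValNat 3 (AddSubgroup.zmultiples P).index = 0 := by
  intro W _ _ N _ K _ _ hO6 hline hN hK hHg hPT hEP 𝔭' h𝔭' he' hf' hrank hSha htam3 P c hc hne
  obtain ⟨hL, hle⟩ := cell_padicLogOrd_le_zero_of_krizLi (ι := embAt K 3 𝔭' h𝔭' he' hf') (P := P) hO6 hc hne
  have hPinf : ¬ IsOfFinAddOrder P := not_isOfFinAddOrder_of_padicLogOmega_ne_zero hL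
  have hShafin : Finite (AddCommGroup.primaryComponent (W.baseChange K).sha 3) := by
    rw [hSha]; infer_instance
  obtain ⟨hfin, a, hcard, ha⟩ := cell_natCard_selmerAcBase_mul_eq W N K hO6 hline hN hK hHg hPT hEP 𝔭' h𝔭'
    he' hf' hrank hShafin P hPinf
  have h1 : padicValNat 3 (Nat.card (AddCommGroup.primaryComponent (W.baseChange K).sha 3)) = 0 := by
    rw [hSha, AddSubgroup.card_bot]; simp
  have h3 : padicValNat 3 (tamagawaProductAbove W K 3) = 0 := padicValNat.eq_zero_of_not_dvd htam3
  rw [h1, h3] at ha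
  -- `a = 2 (ord₃ log P − ord₃ index)` with `ord₃ log P ≤ 0 ≤ ord₃ index` and `a ∈ ℕ`
  simp only [Nat.cast_zero, zero_add, add_zero] at ha
  have ha0 : a = 0 := by omega
  have hlog : Summit.BirchSwinnertonDyer.Rank1Residual.X11b.padicLogOrd W 3 (embAt K 3 𝔭' h𝔭' he' hf') P = 0 := by
    omega
  have hidx0 : padicValNat 3 (AddSubgroup.zmultiples P).index = 0 := by omega
  refine ⟨?_, hPinf, hlog, hidx0⟩
  haveI := hfin
  haveI : Finite (AddCommGroup.primaryComponent (W.baseChange ℚ_[3]).toAffine.Point 3) :=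
    Nat.finite_of_card_ne_zero (by
      intro h0
      rw [h0, mul_zero, ha0, pow_zero] at hcard
      exact zero_ne_one hcard)
  rw [ha0] at hcard
  exact selmerAcBase_eq_bot_of_count_zero (W.baseChange K) 3 𝔭' _ hcard

/-! ## §3 Pointwise K1 on the Kriz–Li locus of the cell -/

/-- **Pointwise K1 on the Kriz–Li locus from two numerics.** On the Leopoldt cell, at a degree-one `𝔭′ ∋ 3` with
`rank E(K) = 1`, `Ш(E/K)[3^∞] = 0`, `3 ∤ ∏_w c_w(E/K)`, and a point `P ∈ E(K)` satisfying Kriz–Li's display at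
`embAt K 3 𝔭′` for some `c` with `3 ∤ c`: for every `ℤ₃`-extension `κ`, generator `γ` and EVERY `L : UnrSeries 3`,
`span{L} ≤ (XAc.charIdeal (E/K) 3 κ 𝔭′ ∅ γ).map toUnr` — the conclusion of crux K1 `CumulativeHeegnerInclusionAtThree`
verbatim for this datum (via `Ch_Λ X_{∅,0}(𝔭′) = Λ`). CONDITIONAL on the two cited cohomological facts; closes nothing
by itself. [cite: KrizLi2019, Thm. 1.20 (pp. 7–8)] [cite: GreenbergLNM1716, §4 Lemma 4.2]
[cite: JetchevSkinnerWan2017, Prop. 3.2.1] -/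
theorem cumulativeHeegnerInclusionAtThree_pointwise_of_krizLi :
    ∀ (W : WeierstrassCurve ℚ) [W.IsElliptic] [W.IsGloballyMinimal] (N : ℕ) [NeZero N] (K : Type) [Field K]
      [NumberField K], Summit.BirchSwinnertonDyer.Rank1Residual.Additive.ClassO6 W 3 →
      (∃ Φ : AddSubgroup (WeierstrassCurve.geomTorsion W ((3 : ℕ) : ℤ)),
        Literature.NumberTheory.EllipticCurves.Rank1Residual.IsRationalLine W 3 Φ ∧
        ∀ (v : IsDedekindDomain.HeightOneSpectrum (NumberField.RingOfIntegers ℚ)),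
          ((3 : ℕ) : NumberField.RingOfIntegers ℚ) ∈ v.asIdeal → ∀ 𝔓 ∈ v.primesAbove,
          ¬ (∀ g ∈ 𝔓.decompositionSubgroup (Field.absoluteGaloisGroup ℚ), ∀ P ∈ Φ, g • P = P) ∧
          ¬ (∀ g ∈ 𝔓.decompositionSubgroup (Field.absoluteGaloisGroup ℚ),
              ∀ P : WeierstrassCurve.geomTorsion W ((3 : ℕ) : ℤ), g • P - P ∈ Φ)) →
      W.conductorNorm ℤ = N → Literature.NumberTheory.EllipticCurves.IsImaginaryQuadratic K →
      Literature.NumberTheory.EllipticCurves.SatisfiesHeegnerHypothesis N K →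
      poitouTate_selmerStructure_duality K →
      (∀ v : HeightOneSpectrum (𝓞 K), localEulerPoincareCharacteristic (v.adicCompletion K)) →
      ∀ (𝔭' : IsDedekindDomain.HeightOneSpectrum (NumberField.RingOfIntegers K))
        (h𝔭' : ((3 : ℕ) : NumberField.RingOfIntegers K) ∈ 𝔭'.asIdeal)
        (he' : 𝔭'.asIdeal.ramificationIdx (𝓞 ℚ) = 1) (hf' : 𝔭'.asIdeal.inertiaDeg (𝓞 ℚ) = 1),
      (W.baseChange K).mordellWeilRank = 1 →
      AddCommGroup.primaryComponent (W.baseChange K).sha 3 = ⊥ →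
      haveI : (W.baseChange K).IsElliptic := inferInstanceAs (W.map (algebraMap ℚ K)).IsElliptic
      ¬ 3 ∣ (W.baseChange K).tamagawaProduct →
      ∀ (P : (W.baseChange K).toAffine.Point) (c : ℤ), ¬ (3 : ℤ) ∣ c →
      ¬ ‖((KrizLi2019.nsPointCount W 3 : ℤ) : ℚ_[3]) / (3 : ℚ_[3]) *
          (Castella2018.padicLogOmega W 3 (embAt K 3 𝔭' h𝔭' he' hf') P / (c : ℚ_[3]))‖ ≤ (3 : ℝ)⁻¹ →
      ∀ (κ : Literature.NumberTheory.EllipticCurves.ZpExtension K 3) (γ : Field.absoluteGaloisGroup K)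
        [Fact (κ.IsTopGenerator γ)] (L : Literature.NumberTheory.EllipticCurves.UnrSeries 3),
        Ideal.span {L} ≤ (Summit.BirchSwinnertonDyer.Rank1Residual.X11b.AcSelmer.XAc.charIdeal
          (W.baseChange K) 3 κ 𝔭' ∅ γ).map
            (PowerSeries.map (Summit.BirchSwinnertonDyer.Rank1Residual.X11b.Halves.toUnr 3)) := by
  intro W _ _ N _ K _ _ hO6 hline hN hK hHg hPT hEP 𝔭' h𝔭' he' hf' hrank hSha htam P c hc hne κ γ _ L
  have htam3 : ¬ 3 ∣ tamagawaProductAbove W K 3 := fun h ↦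
    htam (h.trans (tamagawaProductAbove_dvd_tamagawaProduct W K 3))
  have hbase := (cell_selmerAcBase_eq_bot_of_krizLi W N K hO6 hline hN hK hHg hPT hEP 𝔭' h𝔭' he' hf' hrank
    hSha htam3 P c hc hne).1
  exact cumulativeHeegnerInclusionAtThree_pointwise_of_atoms W N K hO6 hline hN hK hHg κ γ 𝔭' h𝔭' htam hbase L

/-! ## §4 The by-name form: Kriz–Li 2019 Thm. 1.20 as a hypothesis, over its own binders -/

/-- **Pointwise K1 at THE Heegner point of a Kriz–Li datum on the Leopoldt cell, from Kriz–Li 2019 Thm. 1.20 BY NAME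
and two numerics.** For a globally minimal `W/ℚ` on the Leopoldt cell at `3` (class O6, non-anomalous rational line),
an imaginary quadratic `K` with the Heegner hypothesis for `N_W` (so `3 ∣ N_W` splits in `K`), Kriz–Li's binders at
`(W, 3)` — a primitive Dirichlet character `ψ` of conductor `f` and the Teichmüller character `ω` with
`E[3]^{ss} ≅ 𝔽₃(ψ) ⊕ 𝔽₃(ψ⁻¹ω)` in trace form at the primes `ℓ ∤ 3N`, (1) `ψ(3) ≠ 1`, `(ψ⁻¹ω)(3) ≠ 1`, (2) no prime
of split multiplicative reduction, (3) the additive-prime condition — and at `K` — its Kronecker character `ε_K` and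
(4) `B_{1,ψ₀⁻¹ε_K}·B_{1,ψ₀ω⁻¹} ≢ 0 (mod 3)` —, a parametrisation datum `D` of level `N_W` whose constant `c = D.c` is
prime to `3`, a Heegner datum `H`, a complex embedding `ι` and THE Heegner point `P` (`ι(P) = heegnerPointComplex D H`),
with `rank E(K) = 1`, `Ш(E/K)[3^∞] = 0` and `3 ∤ ∏_w c_w(E/K)`: at every degree-one prime `𝔭′ ∋ 3`, for every
`ℤ₃`-extension `κ`, generator `γ` and every `L`, the conclusion of crux K1 verbatim. Kriz–Li is instantiated at the
embedding `embAt K 3 𝔭′`; it supplies `P` non-torsion, `ord₃ log_ω P = 0` and `ord₃[E(K):ℤP] = 0` (§2). CONDITIONAL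
on `hKL` and the two cited cohomological facts; closes nothing by itself (K1 quantifies over the whole cell).
[cite: KrizLi2019, Thm. 1.20 (pp. 7–8) = Thm. 7.1 (pp. 42–43), Rem. 1.17 (p. 6)] [cite: GreenbergLNM1716, §4 Lemma 4.2]
[cite: JetchevSkinnerWan2017, Prop. 3.2.1] [cite: MilneADT2006, Ch. I, Thm. 4.10(b) and Thm. 2.8] -/
theorem cumulativeHeegnerInclusionAtThree_pointwise_of_thm120
    (hKL : KrizLi2019.thm120_padicLogHeegner_unit_of_bernoulli)
    (W : WeierstrassCurve ℚ) [W.IsElliptic] [W.IsGloballyMinimal] [NeZero (W.conductorNorm ℤ)]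
    (K : Type) [Field K] [NumberField K]
    (hO6 : Summit.BirchSwinnertonDyer.Rank1Residual.Additive.ClassO6 W 3)
    (hline : ∃ Φ : AddSubgroup (WeierstrassCurve.geomTorsion W ((3 : ℕ) : ℤ)),
        Literature.NumberTheory.EllipticCurves.Rank1Residual.IsRationalLine W 3 Φ ∧
        ∀ (v : IsDedekindDomain.HeightOneSpectrum (NumberField.RingOfIntegers ℚ)),
          ((3 : ℕ) : NumberField.RingOfIntegers ℚ) ∈ v.asIdeal → ∀ 𝔓 ∈ v.primesAbove,
          ¬ (∀ g ∈ 𝔓.decompositionSubgroup (Field.absoluteGaloisGroup ℚ), ∀ P ∈ Φ, g • P = P) ∧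
          ¬ (∀ g ∈ 𝔓.decompositionSubgroup (Field.absoluteGaloisGroup ℚ),
              ∀ P : WeierstrassCurve.geomTorsion W ((3 : ℕ) : ℤ), g • P - P ∈ Φ))
    (hK : Literature.NumberTheory.EllipticCurves.IsImaginaryQuadratic K)
    (hHg : Literature.NumberTheory.EllipticCurves.SatisfiesHeegnerHypothesis (W.conductorNorm ℤ) K)
    (hPT : poitouTate_selmerStructure_duality K)
    (hEP : ∀ v : HeightOneSpectrum (𝓞 K), localEulerPoincareCharacteristic (v.adicCompletion K))
    -- Kriz–Li's binders at `(W, 3)`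
    (f : ℕ) [NeZero f] (ψ : DirichletCharacter ℚ_[3] f) (ω : DirichletCharacter ℚ_[3] 3)
    (hψ : ψ.IsPrimitive) (hω : KrizLi2019.IsTeichmullerCharacter ω)
    (hss : ∀ ℓ : ℕ, ℓ.Prime → ¬ (ℓ ∣ 3 * W.conductorNorm ℤ) →
      ‖((W.LFunction ℓ : ℤ) : ℚ_[3]) -
          (ψ (ℓ : ZMod f) + ψ⁻¹ (ℓ : ZMod f) * ω (ℓ : ZMod 3))‖ < 1)
    (h1 : ψ (3 : ZMod f) ≠ 1) (h1' : KrizLi2019.primVal (KrizLi2019.invMulOmega ψ ω) 3 ≠ 1)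
    (h2 : ∀ ℓ : ℕ, (hℓ : ℓ.Prime) →
      ¬ (haveI := Fact.mk hℓ; W.HasSplitMultiplicativeReductionAtPrime ℓ))
    (h3 : ∀ ℓ : ℕ, (hℓ : ℓ.Prime) → ℓ ≠ 3 →
      (haveI := Fact.mk hℓ;
        ¬ W.HasGoodReductionAtPrime ℓ ∧ ¬ W.HasMultiplicativeReductionAtPrime ℓ) →
      ψ (ℓ : ZMod f) ≠ 1 ∧ KrizLi2019.primVal (KrizLi2019.invMulOmega ψ ω) ℓ ≠ 1)
    -- Kriz–Li's binders at `K`, the parametrisation and THE Heegner point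
    (εK : DirichletCharacter ℚ_[3] (NumberField.discr K).natAbs)
    (hεK : KrizLi2019.IsKroneckerCharacterOf K εK)
    (h4 : ¬ (‖KrizLi2019.bernoulliOnePrim (KrizLi2019.bernoulliCharOne ψ εK) *
        KrizLi2019.bernoulliOnePrim (KrizLi2019.bernoulliCharTwo ψ εK ω)‖ ≤ (3 : ℝ)⁻¹))
    (D : ModularParametrizationData W (W.conductorNorm ℤ)) (hc : ¬ (3 : ℤ) ∣ D.maninConstant)
    (H : HeegnerDatum (W.conductorNorm ℤ) (NumberField.discr K)) (ι : K →+* ℂ)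
    (P : (W.baseChange K).toAffine.Point)
    (hP : WeierstrassCurve.Affine.Point.map ι.toRatAlgHom P = heegnerPointComplex D H)
    -- the two numerics
    (hrank : (W.baseChange K).mordellWeilRank = 1)
    (hSha : AddCommGroup.primaryComponent (W.baseChange K).sha 3 = ⊥)
    (htam : haveI : (W.baseChange K).IsElliptic := inferInstanceAs (W.map (algebraMap ℚ K)).IsElliptic
      ¬ 3 ∣ (W.baseChange K).tamagawaProduct)
    -- the frame
    (𝔭' : IsDedekindDomain.HeightOneSpectrum (NumberField.RingOfIntegers K))
    (h𝔭' : ((3 : ℕ) : NumberField.RingOfIntegers K) ∈ 𝔭'.asIdeal)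
    (he' : 𝔭'.asIdeal.ramificationIdx (𝓞 ℚ) = 1) (hf' : 𝔭'.asIdeal.inertiaDeg (𝓞 ℚ) = 1)
    (κ : Literature.NumberTheory.EllipticCurves.ZpExtension K 3) (γ : Field.absoluteGaloisGroup K)
    [Fact (κ.IsTopGenerator γ)] (L : Literature.NumberTheory.EllipticCurves.UnrSeries 3) :
    Ideal.span {L} ≤ (Summit.BirchSwinnertonDyer.Rank1Residual.X11b.AcSelmer.XAc.charIdeal
      (W.baseChange K) 3 κ 𝔭' ∅ γ).map
        (PowerSeries.map (Summit.BirchSwinnertonDyer.Rank1Residual.X11b.Halves.toUnr 3)) := by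
  haveI : NeZero (NumberField.discr K).natAbs :=
    ⟨Int.natAbs_ne_zero.mpr (NumberField.discr_ne_zero K)⟩
  have h3N : 3 ∣ W.conductorNorm ℤ :=
    (W.dvd_conductorNorm_iff_not_hasGoodReductionAtPrime 3).mpr hO6.2.1.1
  have hsplit : ((Ideal.span {((3 : ℕ) : ℤ)}).primesOver (𝓞 K)).ncard = 2 := hHg 3 Nat.prime_three h3N
  have hne := hKL 3 (by norm_num) W f ψ ω hψ hω hss h1 h1' h2 h3 D K hK hHg hsplit εK hεK H ι
    (embAt K 3 𝔭' h𝔭' he' hf') P hP h4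
  have hne' : ¬ ‖((KrizLi2019.nsPointCount W 3 : ℤ) : ℚ_[3]) / (3 : ℚ_[3]) *
      (Castella2018.padicLogOmega W 3 (embAt K 3 𝔭' h𝔭' he' hf') P / (D.maninConstant : ℚ_[3]))‖ ≤
        (3 : ℝ)⁻¹ := by
    simpa only [Nat.cast_ofNat] using hne
  exact cumulativeHeegnerInclusionAtThree_pointwise_of_krizLi W (W.conductorNorm ℤ) K hO6 hline rfl hK hHg hPT
    hEP 𝔭' h𝔭' he' hf' hrank hSha htam P D.maninConstant hc hne' κ γ L

/-- **The same with `rank E(K) = 1` from KOLYVAGIN BY NAME.** Kriz–Li's display makes the Heegner point `P` non-torsion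
(§1), so Kolyvagin's theorem (tree named fact `kolyvagin N_W W K`: a non-torsion Heegner point gives `rank E(K) = 1` and
`Ш(E/K)` finite; Gross 1991 Thm. 1.3) supplies the rank hypothesis of `cumulativeHeegnerInclusionAtThree_pointwise_of_thm120`.
Net input at a Kriz–Li datum of the Leopoldt cell: {Kriz–Li Thm. 1.20, Kolyvagin, Milne I 4.10(b), I 2.8} by name +
`Ш(E/K)[3^∞] = 0`, `3 ∤ ∏_w c_w(E/K)`, `3 ∤ c(D)` ⟹ the conclusion of crux K1 at every frame over every degree-one
`𝔭′ ∋ 3`. CONDITIONAL on the four named facts; closes nothing by itself. [cite: KrizLi2019, Thm. 1.20 (pp. 7–8)]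
[cite: Gross1991, Thm. 1.3 (Kolyvagin)] [cite: GreenbergLNM1716, §4 Lemma 4.2] [cite: MilneADT2006, Ch. I, Thm. 4.10(b) and Thm. 2.8] -/
theorem cumulativeHeegnerInclusionAtThree_pointwise_of_thm120_of_kolyvagin
    (hKL : KrizLi2019.thm120_padicLogHeegner_unit_of_bernoulli)
    (W : WeierstrassCurve ℚ) [W.IsElliptic] [W.IsGloballyMinimal] [NeZero (W.conductorNorm ℤ)]
    (K : Type) [Field K] [NumberField K]
    (hKo : kolyvagin (W.conductorNorm ℤ) W K)
    (hO6 : Summit.BirchSwinnertonDyer.Rank1Residual.Additive.ClassO6 W 3)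
    (hline : ∃ Φ : AddSubgroup (WeierstrassCurve.geomTorsion W ((3 : ℕ) : ℤ)),
        Literature.NumberTheory.EllipticCurves.Rank1Residual.IsRationalLine W 3 Φ ∧
        ∀ (v : IsDedekindDomain.HeightOneSpectrum (NumberField.RingOfIntegers ℚ)),
          ((3 : ℕ) : NumberField.RingOfIntegers ℚ) ∈ v.asIdeal → ∀ 𝔓 ∈ v.primesAbove,
          ¬ (∀ g ∈ 𝔓.decompositionSubgroup (Field.absoluteGaloisGroup ℚ), ∀ P ∈ Φ, g • P = P) ∧
          ¬ (∀ g ∈ 𝔓.decompositionSubgroup (Field.absoluteGaloisGroup ℚ),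
              ∀ P : WeierstrassCurve.geomTorsion W ((3 : ℕ) : ℤ), g • P - P ∈ Φ))
    (hK : Literature.NumberTheory.EllipticCurves.IsImaginaryQuadratic K)
    (hHg : Literature.NumberTheory.EllipticCurves.SatisfiesHeegnerHypothesis (W.conductorNorm ℤ) K)
    (hPT : poitouTate_selmerStructure_duality K)
    (hEP : ∀ v : HeightOneSpectrum (𝓞 K), localEulerPoincareCharacteristic (v.adicCompletion K))
    -- Kriz–Li's binders at `(W, 3)`
    (f : ℕ) [NeZero f] (ψ : DirichletCharacter ℚ_[3] f) (ω : DirichletCharacter ℚ_[3] 3)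
    (hψ : ψ.IsPrimitive) (hω : KrizLi2019.IsTeichmullerCharacter ω)
    (hss : ∀ ℓ : ℕ, ℓ.Prime → ¬ (ℓ ∣ 3 * W.conductorNorm ℤ) →
      ‖((W.LFunction ℓ : ℤ) : ℚ_[3]) -
          (ψ (ℓ : ZMod f) + ψ⁻¹ (ℓ : ZMod f) * ω (ℓ : ZMod 3))‖ < 1)
    (h1 : ψ (3 : ZMod f) ≠ 1) (h1' : KrizLi2019.primVal (KrizLi2019.invMulOmega ψ ω) 3 ≠ 1)
    (h2 : ∀ ℓ : ℕ, (hℓ : ℓ.Prime) →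
      ¬ (haveI := Fact.mk hℓ; W.HasSplitMultiplicativeReductionAtPrime ℓ))
    (h3 : ∀ ℓ : ℕ, (hℓ : ℓ.Prime) → ℓ ≠ 3 →
      (haveI := Fact.mk hℓ;
        ¬ W.HasGoodReductionAtPrime ℓ ∧ ¬ W.HasMultiplicativeReductionAtPrime ℓ) →
      ψ (ℓ : ZMod f) ≠ 1 ∧ KrizLi2019.primVal (KrizLi2019.invMulOmega ψ ω) ℓ ≠ 1)
    -- Kriz–Li's binders at `K`, the parametrisation and THE Heegner point
    (εK : DirichletCharacter ℚ_[3] (NumberField.discr K).natAbs)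
    (hεK : KrizLi2019.IsKroneckerCharacterOf K εK)
    (h4 : ¬ (‖KrizLi2019.bernoulliOnePrim (KrizLi2019.bernoulliCharOne ψ εK) *
        KrizLi2019.bernoulliOnePrim (KrizLi2019.bernoulliCharTwo ψ εK ω)‖ ≤ (3 : ℝ)⁻¹))
    (D : ModularParametrizationData W (W.conductorNorm ℤ)) (hc : ¬ (3 : ℤ) ∣ D.maninConstant)
    (H : HeegnerDatum (W.conductorNorm ℤ) (NumberField.discr K)) (ι : K →+* ℂ)
    (P : (W.baseChange K).toAffine.Point)
    (hP : WeierstrassCurve.Affine.Point.map ι.toRatAlgHom P = heegnerPointComplex D H)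
    -- the two numerics
    (hSha : AddCommGroup.primaryComponent (W.baseChange K).sha 3 = ⊥)
    (htam : haveI : (W.baseChange K).IsElliptic := inferInstanceAs (W.map (algebraMap ℚ K)).IsElliptic
      ¬ 3 ∣ (W.baseChange K).tamagawaProduct)
    -- the frame
    (𝔭' : IsDedekindDomain.HeightOneSpectrum (NumberField.RingOfIntegers K))
    (h𝔭' : ((3 : ℕ) : NumberField.RingOfIntegers K) ∈ 𝔭'.asIdeal)
    (he' : 𝔭'.asIdeal.ramificationIdx (𝓞 ℚ) = 1) (hf' : 𝔭'.asIdeal.inertiaDeg (𝓞 ℚ) = 1)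
    (κ : Literature.NumberTheory.EllipticCurves.ZpExtension K 3) (γ : Field.absoluteGaloisGroup K)
    [Fact (κ.IsTopGenerator γ)] (L : Literature.NumberTheory.EllipticCurves.UnrSeries 3) :
    Ideal.span {L} ≤ (Summit.BirchSwinnertonDyer.Rank1Residual.X11b.AcSelmer.XAc.charIdeal
      (W.baseChange K) 3 κ 𝔭' ∅ γ).map
        (PowerSeries.map (Summit.BirchSwinnertonDyer.Rank1Residual.X11b.Halves.toUnr 3)) := by
  haveI : NeZero (NumberField.discr K).natAbs :=
    ⟨Int.natAbs_ne_zero.mpr (NumberField.discr_ne_zero K)⟩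
  have h3N : 3 ∣ W.conductorNorm ℤ :=
    (W.dvd_conductorNorm_iff_not_hasGoodReductionAtPrime 3).mpr hO6.2.1.1
  have hsplit : ((Ideal.span {((3 : ℕ) : ℤ)}).primesOver (𝓞 K)).ncard = 2 := hHg 3 Nat.prime_three h3N
  have hne := hKL 3 (by norm_num) W f ψ ω hψ hω hss h1 h1' h2 h3 D K hK hHg hsplit εK hεK H ι
    (embAt K 3 𝔭' h𝔭' he' hf') P hP h4
  have hne' : ¬ ‖((KrizLi2019.nsPointCount W 3 : ℤ) : ℚ_[3]) / (3 : ℚ_[3]) *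
      (Castella2018.padicLogOmega W 3 (embAt K 3 𝔭' h𝔭' he' hf') P / (D.maninConstant : ℚ_[3]))‖ ≤
        (3 : ℝ)⁻¹ := by
    simpa only [Nat.cast_ofNat] using hne
  have hPinf : ¬ IsOfFinAddOrder P :=
    not_isOfFinAddOrder_of_padicLogOmega_ne_zero (cell_padicLogOrd_le_zero_of_krizLi hO6 hc hne').1
  haveI : (W.baseChange K).IsElliptic := inferInstanceAs (W.map (algebraMap ℚ K)).IsElliptic
  have hrank : (W.baseChange K).mordellWeilRank = 1 := (hKo hK hHg ⟨D, H, ι, hP⟩ hPinf).1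
  exact cumulativeHeegnerInclusionAtThree_pointwise_of_thm120 hKL W K hO6 hline hK hHg hPT hEP f ψ ω hψ hω hss
    h1 h1' h2 h3 εK hεK h4 D hc H ι P hP hrank hSha htam 𝔭' h𝔭' he' hf' κ γ L

end Summit.BirchSwinnertonDyer.BirchSwinnertonDyer.Theorems.CumulativeHeegnerInclusionAtThreeVanishingDoorKrizLi

end
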